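import Mathlib.Analysis.SpecialFunctions.Log.Basic
import Mathlib.Analysis.SpecialFunctions.Exponential
import Mathlib.Algebra.Order.Archimedean.Basic
import Literature.MathematicalPhysics.QuantumLattice.TorusShellCounting
import HarnessLib

/-!
# The thermal shell sum on the square-lattice torus: `Σ_k e^{-β|ε_L(k) - μ|/2} ≲ L²/β + L`

Topic `MathematicalPhysics/QuantumLattice`; continuation of `TorusShellCounting.lean`
(`card_torusShell_le`: `#{k : |ε_L(k) - μ| < η} ≤ 4L(ηL/(2π√(d₀/8)) + 1)` for `0 < η ≤ d₀/2` when
`μ + 4, -μ ≥ d₀`) and companion of `TorusFermiWeightSum.lean` (the Cooper logarithm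
`Σ_k β/(2 + β|ξ_k|) ≲ (1 + log β)L² + βL`). For the free band `ε_L` of the `L × L` torus
(`torusBand`) and `μ` at distance `≥ d₀` from `{-4, 0}` we PROVE the **thermal shell sum**

  `Σ_{k ∈ (ℤ/Lℤ)²} e^{-β|ε_L(k) - μ|/2} ≤ C(d₀)(L²/β + L)`   (`β ≥ 1`, all `L ≥ 1`)

(`exists_sum_exp_neg_mul_abs_torusBand_le`): only the `O(L²/β + L)` levels within `O(1/β)` of the
Fermi curve are thermally active. Method: the pointwise dyadic domination
`e^{-Bt/2} ≤ e^{-2^J/2} + Σ_{j ≤ J} 2e^{-2^j/4}𝟙[t < 2^j/B]` (`exp_neg_half_mul_le_dyadic`), the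
shell count at the `J + 1` dyadic levels `2^j/β ≤ d₀/2`, and the fact that the weights
`2^j e^{-2^j/4}`, `e^{-2^j/4}` are summable WITHOUT a logarithm (`two_pow_mul_exp_neg_le`,
`exp_neg_two_pow_le`; contrast the Cooper weights `1/|ξ|`). Consumer: the Sommerfeld `T²`-law of
the free torus gas, `TorusFreeThermalLaw.lean`.

Sources: M. Salmhofer, *Renormalization* (1999) §4.2–4.5 (lattice Fermi gas at positive
temperature; density of states of the `d = 2` band away from `μ ∈ {0, ±4}`) [Salmhofer1999];
N. W. Ashcroft, N. D. Mermin, *Solid State Physics* (1976) Ch. 2 (only states within `O(k_BT)` of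
the Fermi level are thermally excited) [AshcroftMermin1976]. Everything is proved; no definition
and no named fact.
-/

noncomputable section

namespace Literature.MathematicalPhysics.QuantumLattice

open Real Set Finset Literature.Probability.LatticeModels

/-! ### Elementary exponential bounds -/

/-- `e^{-x} ≤ 1/x` for `x > 0` (from `x + 1 ≤ e^x`). [folklore] -/
theorem exp_neg_le_inv {x : ℝ} (hx : 0 < x) : Real.exp (-x) ≤ 1 / x := by
  rw [Real.exp_neg, ← one_div]
  exact one_div_le_one_div_of_le hx (by linarith [Real.add_one_le_exp x])

/-- `e^{-x} ≤ 6/x³` for `x > 0` (from `x³/3! ≤ e^x`). [folklore] -/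
theorem exp_neg_le_six_div_cube {x : ℝ} (hx : 0 < x) : Real.exp (-x) ≤ 6 / x ^ 3 := by
  have h := Real.pow_div_factorial_le_exp x hx.le 3
  have h3 : (Nat.factorial 3 : ℝ) = 6 := by norm_num [Nat.factorial]
  rw [h3] at h
  rw [Real.exp_neg, inv_eq_one_div, div_le_div_iff₀ (Real.exp_pos x) (by positivity)]
  nlinarith

/-- The dyadic weights are summable without a logarithm, I:
`2^j e^{-2^j/4} ≤ 384/4^j`. [folklore] -/
theorem two_pow_mul_exp_neg_le (j : ℕ) :
    (2 : ℝ) ^ j * Real.exp (-(2 : ℝ) ^ j / 4) ≤ 384 / 4 ^ j := by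
  have hpos : (0 : ℝ) < (2 : ℝ) ^ j / 4 := by positivity
  have h := exp_neg_le_six_div_cube hpos
  rw [neg_div]
  have h4 : (4 : ℝ) ^ j = (2 : ℝ) ^ j * (2 : ℝ) ^ j := by
    rw [← mul_pow]; norm_num
  rw [h4]
  have h2 : (0 : ℝ) < (2 : ℝ) ^ j := by positivity
  calc (2 : ℝ) ^ j * Real.exp (-((2 : ℝ) ^ j / 4)) ≤ (2 : ℝ) ^ j * (6 / ((2 : ℝ) ^ j / 4) ^ 3) :=
        mul_le_mul_of_nonneg_left h h2.le
    _ = 384 / ((2 : ℝ) ^ j * (2 : ℝ) ^ j) := by field_simp; ring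

/-- The dyadic weights are summable without a logarithm, II: `e^{-2^j/4} ≤ 4/2^j`. [folklore] -/
theorem exp_neg_two_pow_le (j : ℕ) : Real.exp (-(2 : ℝ) ^ j / 4) ≤ 4 / 2 ^ j := by
  have hpos : (0 : ℝ) < (2 : ℝ) ^ j / 4 := by positivity
  have h := exp_neg_le_inv hpos
  rw [neg_div]
  calc Real.exp (-((2 : ℝ) ^ j / 4)) ≤ 1 / ((2 : ℝ) ^ j / 4) := h
    _ = 4 / 2 ^ j := by field_simp

/-- `Σ_{j ≤ J} 384/4^j ≤ 512`. [folklore] -/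
theorem sum_dyadicWeight_le (J : ℕ) : ∑ j ∈ Finset.range (J + 1), (384 : ℝ) / 4 ^ j ≤ 512 := by
  have hg := geom_sum_Ico_le_of_lt_one (show (0 : ℝ) ≤ 1 / 4 by norm_num)
    (show (1 : ℝ) / 4 < 1 by norm_num) (m := 0) (n := J + 1)
  simp only [pow_zero, Finset.range_eq_Ico] at hg ⊢
  calc ∑ j ∈ Finset.Ico 0 (J + 1), (384 : ℝ) / 4 ^ j
      = 384 * ∑ j ∈ Finset.Ico 0 (J + 1), ((1 : ℝ) / 4) ^ j := by
        rw [Finset.mul_sum]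
        refine Finset.sum_congr rfl fun j _ => ?_
        rw [one_div, inv_pow]; ring
    _ ≤ 384 * (1 / (1 - 1 / 4)) := by gcongr
    _ = 512 := by norm_num

/-- `Σ_{j ≤ J} 4/2^j ≤ 8`. [folklore] -/
theorem sum_dyadicWeight_le' (J : ℕ) : ∑ j ∈ Finset.range (J + 1), (4 : ℝ) / 2 ^ j ≤ 8 := by
  have hg := geom_sum_Ico_le_of_lt_one (show (0 : ℝ) ≤ 1 / 2 by norm_num)
    (show (1 : ℝ) / 2 < 1 by norm_num) (m := 0) (n := J + 1)
  simp only [pow_zero, Finset.range_eq_Ico] at hg ⊢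
  calc ∑ j ∈ Finset.Ico 0 (J + 1), (4 : ℝ) / 2 ^ j
      = 4 * ∑ j ∈ Finset.Ico 0 (J + 1), ((1 : ℝ) / 2) ^ j := by
        rw [Finset.mul_sum]
        refine Finset.sum_congr rfl fun j _ => ?_
        rw [one_div, inv_pow]; ring
    _ ≤ 4 * (1 / (1 - 1 / 2)) := by gcongr
    _ = 8 := by norm_num

/-! ### Pointwise dyadic domination of the thermal weight `e^{-Bt/2}` -/

/-- For `B > 0`, `t ≥ 0` and every `J`,
`e^{-Bt/2} ≤ e^{-2^J/2} + Σ_{j ≤ J} 2e^{-2^j/4}·𝟙[t < 2^j/B]` (the least dyadic level above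
`t` dominates; below `1/B` the `j = 0` term `2e^{-1/4} ≥ 1` does). [folklore] -/
theorem exp_neg_half_mul_le_dyadic {B t : ℝ} (hB : 0 < B) (ht : 0 ≤ t) (J : ℕ) :
    Real.exp (-(B * t) / 2) ≤ Real.exp (-(2 : ℝ) ^ J / 2) +
      ∑ j ∈ Finset.range (J + 1),
        (if t < 2 ^ j / B then 2 * Real.exp (-(2 : ℝ) ^ j / 4) else 0) := by
  have hsum_nonneg : 0 ≤ ∑ j ∈ Finset.range (J + 1),
      (if t < 2 ^ j / B then 2 * Real.exp (-(2 : ℝ) ^ j / 4) else 0) :=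
    Finset.sum_nonneg fun j _ => by split_ifs <;> positivity
  have htail_nonneg : 0 ≤ Real.exp (-(2 : ℝ) ^ J / 2) := (Real.exp_pos _).le
  by_cases hcase : 2 ^ J / B ≤ t
  · -- beyond the last level: the tail term dominates
    have h1 : Real.exp (-(B * t) / 2) ≤ Real.exp (-(2 : ℝ) ^ J / 2) := by
      rw [Real.exp_le_exp]
      rw [div_le_iff₀ hB] at hcase
      linarith
    linarith
  · rw [not_le] at hcase
    have hex : ∃ j, t < 2 ^ j / B := ⟨J, hcase⟩
    classical
    set i := Nat.find hex with hi
    have hi_spec : t < 2 ^ i / B := Nat.find_spec hex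
    have hi_le : i ≤ J := Nat.find_min' hex hcase
    have hterm : Real.exp (-(B * t) / 2) ≤ 2 * Real.exp (-(2 : ℝ) ^ i / 4) := by
      rcases Nat.eq_zero_or_pos i with h0 | hpos
      · -- `t < 1/B`: `e^{-Bt/2} ≤ 1 ≤ 2e^{-1/4}`
        rw [h0, pow_zero]
        have h1 : Real.exp (-(B * t) / 2) ≤ 1 := by
          rw [Real.exp_le_one_iff]
          have : 0 ≤ B * t := by positivity
          linarith
        have h2 : (3 : ℝ) / 4 ≤ Real.exp (-(1 : ℝ) / 4) := by
          have := Real.one_sub_le_exp_neg ((1 : ℝ) / 4)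
          rw [neg_div]
          linarith
        linarith
      · obtain ⟨i', hi'⟩ := Nat.exists_eq_add_one_of_ne_zero hpos.ne'
        have hlt : i' < Nat.find hex := by rw [← hi, hi']; exact Nat.lt_succ_self i'
        have hnot : ¬ t < 2 ^ i' / B := Nat.find_min hex hlt
        rw [not_lt, div_le_iff₀ hB] at hnot
        rw [hi']
        have h1 : Real.exp (-(B * t) / 2) ≤ Real.exp (-(2 : ℝ) ^ (i' + 1) / 4) := by
          rw [Real.exp_le_exp, pow_succ]
          linarith
        linarith [Real.exp_pos (-(2 : ℝ) ^ (i' + 1) / 4)]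
    have hsingle : (2 * Real.exp (-(2 : ℝ) ^ i / 4) : ℝ) ≤ ∑ j ∈ Finset.range (J + 1),
        (if t < 2 ^ j / B then 2 * Real.exp (-(2 : ℝ) ^ j / 4) else 0) := by
      have := Finset.single_le_sum
        (f := fun j => (if t < 2 ^ j / B then 2 * Real.exp (-(2 : ℝ) ^ j / 4) else (0 : ℝ)))
        (fun j _ => by split_ifs <;> positivity) (Finset.mem_range.2 (Nat.lt_succ_of_le hi_le))
      simpa [hi_spec] using this
    linarith

/-! ### The thermal shell sum -/

/-- **The thermal shell sum.** For `μ` with `μ + 4 ≥ d₀`, `-μ ≥ d₀` there is `C = C(d₀)` such that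
for all `β ≥ 1` and all `L ≥ 1`,
`Σ_{k ∈ (ℤ/Lℤ)²} e^{-β|ε_L(k) - μ|/2} ≤ C (L²/β + L)`: the number of thermally active levels is
`O(L²T)` (density of states × temperature) up to the `O(L)` discretisation error of the level
count. [cite: Salmhofer1999, §4.5.4] -/
theorem exists_sum_exp_neg_mul_abs_torusBand_le {d₀ : ℝ} (hd₀ : 0 < d₀) :
    ∃ C : ℝ, 0 < C ∧ ∀ μ : ℝ, d₀ ≤ μ + 4 → d₀ ≤ -μ → ∀ β : ℝ, 1 ≤ β → ∀ (L : ℕ) [NeZero L],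
      ∑ k : TorusSite 2 L, Real.exp (-(β * |torusBand L k - μ|) / 2) ≤
        C * ((L : ℝ) ^ 2 / β + L) := by
  set s₀ := Real.sqrt (d₀ / 8) with hs₀def
  have hs₀ : 0 < s₀ := Real.sqrt_pos.2 (by positivity)
  refine ⟨8 / d₀ + 2048 / (π * s₀) + 64, by positivity, ?_⟩
  intro μ hμ4 hμ0 β hβ L _
  have hL : (0 : ℝ) < L := by exact_mod_cast Nat.pos_of_ne_zero (NeZero.ne L)
  have hβ0 : 0 < β := by linarith
  set η₀ := d₀ / 4 with hη₀def
  have hη₀ : 0 < η₀ := by positivity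
  have hcardL : (Finset.univ : Finset (TorusSite 2 L)).card = L ^ 2 := by
    rw [Finset.card_univ, Fintype.card_pi, Fin.prod_univ_two, ZMod.card, sq]
  have hL2 : (0 : ℝ) ≤ (L : ℝ) ^ 2 / β := by positivity
  have hA : (0 : ℝ) ≤ 2048 / (π * s₀) := by positivity
  by_cases hsmall : β * η₀ ≤ 1
  · -- small `β ≤ 4/d₀`: every weight is `≤ 1`, and `L² ≤ (4/d₀) L²/β`
    have hbound : ∀ k : TorusSite 2 L, Real.exp (-(β * |torusBand L k - μ|) / 2) ≤ 1 := fun k => by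
      rw [Real.exp_le_one_iff]
      have : 0 ≤ β * |torusBand L k - μ| := by positivity
      linarith
    calc ∑ k : TorusSite 2 L, Real.exp (-(β * |torusBand L k - μ|) / 2)
        ≤ ∑ _k : TorusSite 2 L, (1 : ℝ) := Finset.sum_le_sum fun k _ => hbound k
      _ = (L : ℝ) ^ 2 := by rw [Finset.sum_const, hcardL, nsmul_eq_mul, mul_one]; push_cast; ring
      _ ≤ 8 / d₀ * ((L : ℝ) ^ 2 / β) := by
          rw [hη₀def] at hsmall
          rw [mul_div_assoc', le_div_iff₀ hβ0]
          have h2 : (0 : ℝ) ≤ (L : ℝ) ^ 2 := by positivity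
          have h3 : β ≤ 8 / d₀ := by rw [le_div_iff₀ hd₀]; nlinarith
          nlinarith
      _ ≤ (8 / d₀ + 2048 / (π * s₀) + 64) * ((L : ℝ) ^ 2 / β + L) := by
          have h1 : (0 : ℝ) ≤ 8 / d₀ := by positivity
          nlinarith [mul_nonneg hA hL2, mul_nonneg hA hL.le, mul_nonneg h1 hL.le, hL2, hL.le]
  · -- dyadic decomposition up to the level `2^J/β ∈ (η₀, 2η₀] ⊂ (d₀/4, d₀/2]`
    rw [not_le] at hsmall
    obtain ⟨n, hn1, hn2⟩ := exists_nat_pow_near hsmall.le one_lt_two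
    set J := n + 1 with hJdef
    have hJ1 : β * η₀ < 2 ^ J := by rw [hJdef]; exact hn2
    have hJ2 : (2 : ℝ) ^ J / β ≤ d₀ / 2 := by
      rw [div_le_iff₀ hβ0, hJdef, pow_succ]; nlinarith
    -- the tail `e^{-2^J/2} ≤ e^{-βη₀/2} ≤ 2/(βη₀) = (8/d₀)/β`
    have htail : Real.exp (-(2 : ℝ) ^ J / 2) ≤ 8 / d₀ / β := by
      have h1 : Real.exp (-(2 : ℝ) ^ J / 2) ≤ Real.exp (-(β * η₀ / 2)) := by
        rw [Real.exp_le_exp]; linarith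
      have h2 : Real.exp (-(β * η₀ / 2)) ≤ 1 / (β * η₀ / 2) := exp_neg_le_inv (by positivity)
      have h3 : 1 / (β * η₀ / 2) = 8 / d₀ / β := by rw [hη₀def]; field_simp; ring
      linarith [h3.le, h3.ge]
    -- pointwise domination
    have hpt : ∀ k : TorusSite 2 L, Real.exp (-(β * |torusBand L k - μ|) / 2) ≤
        Real.exp (-(2 : ℝ) ^ J / 2) + ∑ j ∈ Finset.range (J + 1),
          (if |torusBand L k - μ| < 2 ^ j / β then 2 * Real.exp (-(2 : ℝ) ^ j / 4) else 0) :=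
      fun k => exp_neg_half_mul_le_dyadic hβ0 (abs_nonneg _) J
    -- shell counts at the dyadic levels
    have hcount : ∀ j ∈ Finset.range (J + 1),
        ∑ k : TorusSite 2 L,
            (if |torusBand L k - μ| < 2 ^ j / β then 2 * Real.exp (-(2 : ℝ) ^ j / 4) else (0 : ℝ)) ≤
          4 * (L : ℝ) ^ 2 / (π * s₀ * β) * ((2 : ℝ) ^ j * Real.exp (-(2 : ℝ) ^ j / 4)) +
            8 * L * Real.exp (-(2 : ℝ) ^ j / 4) := by
      intro j hj
      have hjJ : j ≤ J := Nat.lt_succ_iff.1 (Finset.mem_range.1 hj)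
      have hηj : 0 < (2 : ℝ) ^ j / β := by positivity
      have hηj' : (2 : ℝ) ^ j / β ≤ d₀ / 2 :=
        le_trans (div_le_div_of_nonneg_right (pow_le_pow_right₀ one_le_two hjJ) hβ0.le) hJ2
      have hN := card_torusShell_le (L := L) hμ4 hμ0 hηj hηj'
      rw [← hs₀def] at hN
      rw [← Finset.sum_filter, Finset.sum_const, nsmul_eq_mul]
      have hE : 0 ≤ 2 * Real.exp (-(2 : ℝ) ^ j / 4) := by positivity
      calc (((Finset.univ.filter fun k : TorusSite 2 L =>
              |torusBand L k - μ| < 2 ^ j / β).card : ℕ) : ℝ) *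
            (2 * Real.exp (-(2 : ℝ) ^ j / 4))
          ≤ 4 * (L * (2 ^ j / β * L / (2 * π * s₀) + 1)) * (2 * Real.exp (-(2 : ℝ) ^ j / 4)) :=
            mul_le_mul_of_nonneg_right hN hE
        _ = 4 * (L : ℝ) ^ 2 / (π * s₀ * β) * ((2 : ℝ) ^ j * Real.exp (-(2 : ℝ) ^ j / 4)) +
            8 * L * Real.exp (-(2 : ℝ) ^ j / 4) := by
            field_simp
            ring
    have hsum1 : ∑ j ∈ Finset.range (J + 1), ((2 : ℝ) ^ j * Real.exp (-(2 : ℝ) ^ j / 4)) ≤ 512 :=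
      (Finset.sum_le_sum fun j _ => two_pow_mul_exp_neg_le j).trans (sum_dyadicWeight_le J)
    have hsum2 : ∑ j ∈ Finset.range (J + 1), Real.exp (-(2 : ℝ) ^ j / 4) ≤ 8 :=
      (Finset.sum_le_sum fun j _ => exp_neg_two_pow_le j).trans (sum_dyadicWeight_le' J)
    have hc1 : (0 : ℝ) ≤ 4 * (L : ℝ) ^ 2 / (π * s₀ * β) := by positivity
    calc ∑ k : TorusSite 2 L, Real.exp (-(β * |torusBand L k - μ|) / 2)
        ≤ ∑ k : TorusSite 2 L, (Real.exp (-(2 : ℝ) ^ J / 2) + ∑ j ∈ Finset.range (J + 1),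
            (if |torusBand L k - μ| < 2 ^ j / β then 2 * Real.exp (-(2 : ℝ) ^ j / 4) else 0)) :=
          Finset.sum_le_sum fun k _ => hpt k
      _ = (L : ℝ) ^ 2 * Real.exp (-(2 : ℝ) ^ J / 2) +
          ∑ j ∈ Finset.range (J + 1), ∑ k : TorusSite 2 L,
            (if |torusBand L k - μ| < 2 ^ j / β then 2 * Real.exp (-(2 : ℝ) ^ j / 4)
              else (0 : ℝ)) := by
          rw [Finset.sum_add_distrib, Finset.sum_const, hcardL, nsmul_eq_mul, Finset.sum_comm]
          push_cast; ring
      _ ≤ (L : ℝ) ^ 2 * (8 / d₀ / β) + ∑ j ∈ Finset.range (J + 1),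
            (4 * (L : ℝ) ^ 2 / (π * s₀ * β) * ((2 : ℝ) ^ j * Real.exp (-(2 : ℝ) ^ j / 4)) +
              8 * L * Real.exp (-(2 : ℝ) ^ j / 4)) := by
          gcongr with j hj
          exact hcount j hj
      _ = (L : ℝ) ^ 2 * (8 / d₀ / β) +
            (4 * (L : ℝ) ^ 2 / (π * s₀ * β) *
                ∑ j ∈ Finset.range (J + 1), ((2 : ℝ) ^ j * Real.exp (-(2 : ℝ) ^ j / 4)) +
              8 * L * ∑ j ∈ Finset.range (J + 1), Real.exp (-(2 : ℝ) ^ j / 4)) := by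
          rw [Finset.sum_add_distrib, Finset.mul_sum, Finset.mul_sum]
      _ ≤ (L : ℝ) ^ 2 * (8 / d₀ / β) + (4 * (L : ℝ) ^ 2 / (π * s₀ * β) * 512 + 8 * L * 8) := by
          gcongr
      _ = (8 / d₀ + 2048 / (π * s₀)) * ((L : ℝ) ^ 2 / β) + 64 * L := by
          field_simp
          ring
      _ ≤ (8 / d₀ + 2048 / (π * s₀) + 64) * ((L : ℝ) ^ 2 / β + L) := by
          have h1 : (0 : ℝ) ≤ 8 / d₀ := by positivity
          nlinarith [mul_nonneg h1 hL.le, mul_nonneg hA hL.le, hL2]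

end Literature.MathematicalPhysics.QuantumLattice
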